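import Summits.AtomisticToContinuum.FouriersLaw.Theorems.LocalOhmBVLocalOhmStubGibbsTermCovarianceDecayAux2
import Summits.AtomisticToContinuum.FouriersLaw.Theorems.HeatModeWeylLawSpecificHeatLimitIdentities

/-!
# Per-term covariance decay for the free finite Gibbs state (stub `stub_gibbsTermCovarianceDecay`),
# helper III: Gibbs-type integrals with a window observable and one insertion as `L²` pairings

Helper file for crux item stmt-AtomisticToContinuum-12009 (`LocalOhmBV.LocalOhm`, line `registered`,
stub T2 `stub_gibbsTermCovarianceDecay`); continuation of `…GibbsTermCovarianceDecayAux1/2`. Abstract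
one-site space `Y` with a FINITE a priori measure `ρ`, symmetrised kernel `k = a K₀ a` (bounded by
`C`), weight `w`, the `L²(ρ)` transfer operator `A` of `k` and an insertion operator `H` of the bounded
kernel `k · ins` (both entering through their a.e. kernel formulas, as delivered by the tree's
`Literature.Analysis.OperatorTheory.exists_kernelOp` / `exists_transferOperator`):

* `exists_rightVector`, `exists_rightVector_one` — the right block integrated out with the boundary
  spin `u` frozen is a bounded, strongly measurable function `R(u)`, a.e. equal to the operator word
  `Aʲ H A^{m-1-j} [a]` (one insertion on the bond `j` of the block) resp. `Aᵐ [a]` (no insertion):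
  instances of the tree's `SpecificHeatLimit.hetPath_spec` + `listProd_one_insertion`;
* `integral_mul_w_eq_inner` (**core representation**) — for an observable
  `F(append ξ η) = Gl(ξ) Fr(ξ_e, η)` of the `(e+1+m)`-chain: `∫ F w dπ = ⟪[Ĝ], W⟫_{L²(ρ)}` with the left
  vector `Ĝ` of `memLp_leftVector` and any `L²` class `W` a.e. equal to the right function;
* `integral_w_eq_inner_pow` — the partition function: `∫ w_M dπ_M = ⟪[a], A^{M-1} [a]⟫` (`M ≥ 1`).

All [folklore]; no definitions.
-/

set_option autoImplicit false

noncomputable section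

namespace Summit.AtomisticToContinuum.FouriersLaw.Theorems.LocalOhmBirth.TermDecay

open MeasureTheory Filter Topology Function
open scoped BigOperators ENNReal RealInnerProductSpace
open Literature.Analysis.OperatorTheory
open Summit.AtomisticToContinuum.FouriersLaw.Theorems.SpecificHeatLimit

variable {Y : Type*} [MeasurableSpace Y] {ρ : Measure Y} [IsFiniteMeasure ρ]
variable {a : Y → ℝ} {K₀ k : Y → Y → ℝ} {w : (N : ℕ) → (Fin N → Y) → ℝ}

/-! ### The right block as a heterogeneous path functional -/

/-- **The right block with one insertion.** For the bounded symmetrised kernel `k`, a bond insertion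
`ins` with `k · ins` bounded, their `L²(ρ)` realisations `A`, `H`, a block of `m` sites and a bond
index `j < m`: the function
`R(u) = ∫ ins((u∷η)ⱼ, ηⱼ) (∏_{i<m} k((u∷η)ᵢ, ηᵢ)) a((u∷η)_m) dπ_m(η)` of the boundary spin `u` is
bounded, strongly measurable and a.e. equal to `Aʲ H A^{m-1-j} [a]`. -/
theorem exists_rightVector (ham : Measurable a) (hab : ∀ x, ‖a x‖ ≤ 1)
    (hkm : Measurable (uncurry k)) {C : ℝ} (hkC : ∀ x y, ‖k x y‖ ≤ C)
    {ins : Y → Y → ℝ} (hkim : Measurable (uncurry fun x y => k x y * ins x y))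
    (hkiC : ∀ x y, ‖k x y * ins x y‖ ≤ C)
    {A H : Lp ℝ 2 ρ →L[ℝ] Lp ℝ 2 ρ}
    (hA : ∀ ψ : Lp ℝ 2 ρ, (A ψ : Y → ℝ) =ᵐ[ρ] fun x => ∫ y, k x y * ψ y ∂ρ)
    (hH : ∀ ψ : Lp ℝ 2 ρ, (H ψ : Y → ℝ) =ᵐ[ρ] fun x => ∫ y, (k x y * ins x y) * ψ y ∂ρ)
    (m : ℕ) (j : Fin m) :
    ∃ R : Y → ℝ,
      (∀ u, R u = ∫ η, ins ((Fin.cons u η : Fin (m + 1) → Y) (Fin.castSucc j)) (η j) *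
        ((∏ i : Fin m, k ((Fin.cons u η : Fin (m + 1) → Y) (Fin.castSucc i)) (η i)) *
          a ((Fin.cons u η : Fin (m + 1) → Y) (Fin.last m))) ∂(Measure.pi fun _ : Fin m => ρ)) ∧
      (∃ B, ∀ u, ‖R u‖ ≤ B) ∧ StronglyMeasurable R ∧
      (R =ᵐ[ρ] (((A ^ (j : ℕ) * H * A ^ (m - 1 - (j : ℕ))) ((memLp_two_of_bound ham hab).toLp a) :
        Lp ℝ 2 ρ) : Y → ℝ)) := by
  classical
  set Kf : ℕ → Y → Y → ℝ := fun i x y => if i = (j : ℕ) then k x y * ins x y else k x y with hKf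
  set Op : ℕ → (Lp ℝ 2 ρ →L[ℝ] Lp ℝ 2 ρ) := fun i => if i = (j : ℕ) then H else A with hOp
  have hKfm : ∀ i, Measurable (uncurry (Kf i)) := by
    intro i
    by_cases hi : i = (j : ℕ)
    · have : uncurry (Kf i) = uncurry fun x y => k x y * ins x y := by
        funext p; simp only [uncurry, hKf, hi, if_true]
      rw [this]; exact hkim
    · have : uncurry (Kf i) = uncurry k := by
        funext p; simp only [uncurry, hKf, hi, if_false]
      rw [this]; exact hkm
  have hKfC : ∀ i x y, ‖Kf i x y‖ ≤ C := by
    intro i x y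
    by_cases hi : i = (j : ℕ)
    · simp only [hKf, hi, if_true]; exact hkiC x y
    · simp only [hKf, hi, if_false]; exact hkC x y
  have hOpK : ∀ i (ψ : Lp ℝ 2 ρ), (Op i ψ : Y → ℝ) =ᵐ[ρ] fun x => ∫ y, Kf i x y * ψ y ∂ρ := by
    intro i ψ
    by_cases hi : i = (j : ℕ)
    · simp only [hOp, hKf, hi, if_true]; exact hH ψ
    · simp only [hOp, hKf, hi, if_false]; exact hA ψ
  obtain ⟨⟨B', hB'⟩, hsm, hae⟩ := hetPath_spec (ρ := ρ) (C := C) ham hab m Kf Op hKfm hKfC hOpK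
  -- the path integrand is the stated one
  have hint : ∀ (u : Y) (η : Fin m → Y),
      (∏ i : Fin m, Kf i ((Fin.cons u η : Fin (m + 1) → Y) (Fin.castSucc i)) (η i)) *
        a ((Fin.cons u η : Fin (m + 1) → Y) (Fin.last m)) =
      ins ((Fin.cons u η : Fin (m + 1) → Y) (Fin.castSucc j)) (η j) *
        ((∏ i : Fin m, k ((Fin.cons u η : Fin (m + 1) → Y) (Fin.castSucc i)) (η i)) *
          a ((Fin.cons u η : Fin (m + 1) → Y) (Fin.last m))) := by
    intro u η
    have h1 : ∀ i : Fin m, Kf i ((Fin.cons u η : Fin (m + 1) → Y) (Fin.castSucc i)) (η i) =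
        k ((Fin.cons u η : Fin (m + 1) → Y) (Fin.castSucc i)) (η i) *
          (if i = j then ins ((Fin.cons u η : Fin (m + 1) → Y) (Fin.castSucc i)) (η i) else 1) := by
      intro i
      by_cases hi : i = j
      · subst hi; simp only [hKf, if_true]
      · have hi' : (i : ℕ) ≠ (j : ℕ) := fun h => hi (Fin.ext h)
        simp only [hKf, hi', hi, if_false, mul_one]
    simp_rw [h1]
    rw [Finset.prod_mul_distrib, Finset.prod_ite_eq' Finset.univ j, if_pos (Finset.mem_univ _)]
    ring
  refine ⟨fun u => ∫ ζ : Fin m → Y, (∏ i : Fin m,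
      Kf i ((Fin.cons u ζ : Fin (m + 1) → Y) (Fin.castSucc i)) (ζ i)) *
      a ((Fin.cons u ζ : Fin (m + 1) → Y) (Fin.last m)) ∂(Measure.pi fun _ => ρ),
    fun u => ?_, ⟨B', hB'⟩, hsm, ?_⟩
  · exact integral_congr_ae (ae_of_all _ fun η => hint u η)
  · have hword : ((List.range m).map Op).prod = A ^ (j : ℕ) * H * A ^ (m - 1 - (j : ℕ)) :=
      listProd_one_insertion A H j.isLt
    rw [← hword]
    exact hae

/-- **The right block without insertion**: `R(u) = ∫ (∏_{i<m} k((u∷η)ᵢ, ηᵢ)) a((u∷η)_m) dπ_m(η)` is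
bounded, strongly measurable and a.e. equal to `Aᵐ [a]`. -/
theorem exists_rightVector_one (ham : Measurable a) (hab : ∀ x, ‖a x‖ ≤ 1)
    (hkm : Measurable (uncurry k)) {C : ℝ} (hkC : ∀ x y, ‖k x y‖ ≤ C)
    {A : Lp ℝ 2 ρ →L[ℝ] Lp ℝ 2 ρ}
    (hA : ∀ ψ : Lp ℝ 2 ρ, (A ψ : Y → ℝ) =ᵐ[ρ] fun x => ∫ y, k x y * ψ y ∂ρ) (m : ℕ) :
    ∃ R : Y → ℝ,
      (∀ u, R u = ∫ η, ((∏ i : Fin m, k ((Fin.cons u η : Fin (m + 1) → Y) (Fin.castSucc i)) (η i)) *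
          a ((Fin.cons u η : Fin (m + 1) → Y) (Fin.last m))) ∂(Measure.pi fun _ : Fin m => ρ)) ∧
      (∃ B, ∀ u, ‖R u‖ ≤ B) ∧ StronglyMeasurable R ∧
      (R =ᵐ[ρ] (((A ^ m) ((memLp_two_of_bound ham hab).toLp a) : Lp ℝ 2 ρ) : Y → ℝ)) := by
  obtain ⟨⟨B', hB'⟩, hsm, hae⟩ := hetPath_spec (ρ := ρ) (C := C) ham hab m (fun _ => k) (fun _ => A)
    (fun _ => hkm) (fun _ => hkC) (fun _ => hA)
  refine ⟨_, fun u => rfl, ⟨B', hB'⟩, hsm, ?_⟩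
  have hword : ((List.range m).map fun _ : ℕ => A).prod = A ^ m := by
    rw [List.map_const', List.prod_replicate, List.length_range]
  rw [← hword]
  exact hae

/-! ### The core representation -/

/-- **Gibbs-type integrals with a left observable and a right insertion as `L²(ρ)` pairings.** For an
observable `F(append ξ η) = Gl(ξ) Fr(ξ_e, η)` of the `(e+1+m)`-chain with `F w` integrable, the
right function `R(u) = ∫ Fr(u, η) (∏ k) a dπ_m` bounded and a.e. equal to an `L²` class `W`, and the
left vector `Ĝ ∈ L²(ρ)` (`memLp_leftVector`): `∫ F w_{e+1+m} dπ = ⟪[Ĝ], W⟫`. -/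
theorem integral_mul_w_eq_inner (hk : ∀ x y, k x y = a x * K₀ x y * a y)
    (hw : ∀ (N : ℕ) (ζ : Fin N → Y), w N ζ = (∏ i, a (ζ i) ^ 2) *
      ∏ i : Fin N, ∏ j : Fin N, if j.val = i.val + 1 then K₀ (ζ i) (ζ j) else 1)
    (e m : ℕ) {F : (Fin (e + 1 + m) → Y) → ℝ} {Gl : (Fin (e + 1) → Y) → ℝ} {Fr : Y → (Fin m → Y) → ℝ}
    (hF : ∀ ξ η, F (Fin.append ξ η) = Gl ξ * Fr (ξ (Fin.last e)) η)
    (hFi : Integrable (fun ζ => F ζ * w (e + 1 + m) ζ) (Measure.pi fun _ : Fin (e + 1 + m) => ρ))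
    {R : Y → ℝ}
    (hR : ∀ u, R u = ∫ η, Fr u η * ((∏ i : Fin m, k ((Fin.cons u η : Fin (m + 1) → Y) (Fin.castSucc i)) (η i)) *
      a ((Fin.cons u η : Fin (m + 1) → Y) (Fin.last m))) ∂(Measure.pi fun _ : Fin m => ρ))
    {W : Lp ℝ 2 ρ} (hRW : R =ᵐ[ρ] (W : Y → ℝ))
    {Ĝ : Y → ℝ}
    (hĜ : ∀ x, Ĝ x = ∫ ξ', Gl (Fin.snoc ξ' x) * (a ((Fin.snoc ξ' x : Fin (e + 1) → Y) 0) *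
      ∏ i : Fin e, k ((Fin.snoc ξ' x : Fin (e + 1) → Y) (Fin.castSucc i))
        ((Fin.snoc ξ' x : Fin (e + 1) → Y) i.succ)) ∂(Measure.pi fun _ : Fin e => ρ))
    (hĜ2 : MemLp Ĝ 2 ρ) :
    ∫ ζ, F ζ * w (e + 1 + m) ζ ∂(Measure.pi fun _ : Fin (e + 1 + m) => ρ) = ⟪hĜ2.toLp Ĝ, W⟫ := by
  obtain ⟨h1, h2⟩ := integral_mul_w_split ρ hk hw e m hF hFi hR
  rw [h1, integral_mul_last_eq_integral_snoc ρ e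
    (Φ := fun ξ => Gl ξ * (a (ξ 0) * ∏ i : Fin e, k (ξ (Fin.castSucc i)) (ξ i.succ))) h2,
    inner_eq_integral]
  refine integral_congr_ae ?_
  filter_upwards [hĜ2.coeFn_toLp, hRW] with x hx hRx
  rw [hx, hĜ, hRx]

/-- **The partition function as a matrix element**: `∫ w_M dπ_M = ⟪[a], A^{M-1} [a]⟫` for `M ≥ 1`. -/
theorem integral_w_eq_inner_pow (hk : ∀ x y, k x y = a x * K₀ x y * a y)
    (hw : ∀ (N : ℕ) (ζ : Fin N → Y), w N ζ = (∏ i, a (ζ i) ^ 2) *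
      ∏ i : Fin N, ∏ j : Fin N, if j.val = i.val + 1 then K₀ (ζ i) (ζ j) else 1)
    (ham : Measurable a) (hab : ∀ x, ‖a x‖ ≤ 1)
    (hkm : Measurable (uncurry k)) {C : ℝ} (hkC : ∀ x y, ‖k x y‖ ≤ C)
    {A : Lp ℝ 2 ρ →L[ℝ] Lp ℝ 2 ρ}
    (hA : ∀ ψ : Lp ℝ 2 ρ, (A ψ : Y → ℝ) =ᵐ[ρ] fun x => ∫ y, k x y * ψ y ∂ρ)
    {M : ℕ} (hM : 0 < M) (hWi : Integrable (w M) (Measure.pi fun _ : Fin M => ρ)) :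
    ∫ ζ, w M ζ ∂(Measure.pi fun _ : Fin M => ρ) =
      ⟪(memLp_two_of_bound ham hab).toLp a, (A ^ (M - 1)) ((memLp_two_of_bound ham hab).toLp a)⟫ := by
  obtain ⟨m, rfl⟩ : ∃ m, M = 0 + 1 + m := ⟨M - 1, by omega⟩
  obtain ⟨R, hR, -, -, hRW⟩ := exists_rightVector_one (ρ := ρ) ham hab hkm hkC hA m
  have hF : ∀ (ξ : Fin (0 + 1) → Y) (η : Fin m → Y),
      (fun _ : Fin (0 + 1 + m) → Y => (1 : ℝ)) (Fin.append ξ η) =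
        (fun _ : Fin (0 + 1) → Y => (1 : ℝ)) ξ * (fun (_ : Y) (_ : Fin m → Y) => (1 : ℝ)) (ξ (Fin.last 0)) η := by
    intro ξ η; simp
  have hFi : Integrable (fun ζ => (fun _ : Fin (0 + 1 + m) → Y => (1 : ℝ)) ζ * w (0 + 1 + m) ζ)
      (Measure.pi fun _ : Fin (0 + 1 + m) => ρ) := hWi.congr (ae_of_all _ fun ζ => by simp)
  have hR' : ∀ u, R u = ∫ η, (fun (_ : Y) (_ : Fin m → Y) => (1 : ℝ)) u η *
      ((∏ i : Fin m, k ((Fin.cons u η : Fin (m + 1) → Y) (Fin.castSucc i)) (η i)) *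
        a ((Fin.cons u η : Fin (m + 1) → Y) (Fin.last m))) ∂(Measure.pi fun _ : Fin m => ρ) := by
    intro u; rw [hR]; simp
  have hĜ : ∀ x, a x = ∫ ξ' : Fin 0 → Y, (fun _ : Fin (0 + 1) → Y => (1 : ℝ)) (Fin.snoc ξ' x) *
      (a ((Fin.snoc ξ' x : Fin (0 + 1) → Y) 0) *
        ∏ i : Fin 0, k ((Fin.snoc ξ' x : Fin (0 + 1) → Y) (Fin.castSucc i))
          ((Fin.snoc ξ' x : Fin (0 + 1) → Y) i.succ)) ∂(Measure.pi fun _ : Fin 0 => ρ) := by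
    intro x
    have h0 : ∀ ξ' : Fin 0 → Y, (Fin.snoc ξ' x : Fin (0 + 1) → Y) 0 = x := fun ξ' =>
      Fin.snoc_last (α := fun _ => Y) (x := x) (p := ξ')
    simp only [Finset.univ_eq_empty, Finset.prod_empty, mul_one, one_mul, h0]
    rw [integral_const, measureReal_def, Measure.pi_empty_univ, ENNReal.toReal_one, one_smul]
  have h := integral_mul_w_eq_inner (ρ := ρ) hk hw 0 m hF hFi hR' hRW hĜ (memLp_two_of_bound ham hab)
  simp only [one_mul] at h
  rw [h, show 0 + 1 + m - 1 = m by omega]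


/-- **Headline (registered helper stub).** The partition function of the symmetrised transfer
structure as a matrix element: for a finite one-site measure `ρ` on `ℝ × ℝ`, a site factor `a`
(`|a| ≤ 1`), a bond factor `K₀`, the symmetrised kernel `k = a K₀ a` (bounded, measurable) with `L²(ρ)`
transfer operator `A`, and the weight `w` of the chain relative to `ρ^{⊗M}`:
`∫ w_M dρ^{⊗M} = ⟪[a], A^{M-1} [a]⟫` for every `M ≥ 1` with `w_M` integrable. -/
theorem partitionFunction_eq_inner_transferPow :
    ∀ (ρ : Measure (ℝ × ℝ)) [IsFiniteMeasure ρ] (a : ℝ × ℝ → ℝ) (K₀ k : ℝ × ℝ → ℝ × ℝ → ℝ)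
      (w : (N : ℕ) → (Fin N → ℝ × ℝ) → ℝ),
      (∀ x y, k x y = a x * K₀ x y * a y) →
      (∀ (N : ℕ) (ζ : Fin N → ℝ × ℝ), w N ζ = (∏ i, a (ζ i) ^ 2) *
        ∏ i : Fin N, ∏ j : Fin N, if j.val = i.val + 1 then K₀ (ζ i) (ζ j) else 1) →
      ∀ (ham : Measurable a) (hab : ∀ x, ‖a x‖ ≤ 1), Measurable (uncurry k) →
      ∀ (C : ℝ), (∀ x y, ‖k x y‖ ≤ C) →
      ∀ (A : Lp ℝ 2 ρ →L[ℝ] Lp ℝ 2 ρ),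
      (∀ ψ : Lp ℝ 2 ρ, (A ψ : ℝ × ℝ → ℝ) =ᵐ[ρ] fun x => ∫ y, k x y * ψ y ∂ρ) →
      ∀ (M : ℕ), 0 < M → Integrable (w M) (Measure.pi fun _ : Fin M => ρ) →
        ∫ ζ, w M ζ ∂(Measure.pi fun _ : Fin M => ρ) =
          ⟪(memLp_two_of_bound ham hab).toLp a, (A ^ (M - 1)) ((memLp_two_of_bound ham hab).toLp a)⟫ := by
  intro ρ _ a K₀ k w hk hw ham hab hkm C hkC A hA M hM hWi
  exact integral_w_eq_inner_pow hk hw ham hab hkm hkC hA hM hWi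

end Summit.AtomisticToContinuum.FouriersLaw.Theorems.LocalOhmBirth.TermDecay

end
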